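import Summits.Ventures.PercRepro.S1TriangleCountSharp
import Summits.Ventures.PercRepro.S2TelescopeCount

/-!
# PercRepro — THE INDEPENDENT `7`-SETS AGAINST THE TRIANGLES: a Bonferroni count (p8, gen 21; a feeder for S4 — the top of
the `q = 7` window, the row `43`)

A `7`-subset of `E` containing a triangle is dependent. Counting the pairs `(T, S)` — a triangle `T` inside a `7`-set `S` —
in two ways: every triangle lies in `≥ C(n − 3, 4)` seven-sets (`U ↦ U ∪ T`); a `7`-set `S` with `m_S ≥ 1` triangles is counted
`m_S ≤ 1 + C(m_S, 2)` times, and `Σ_S C(m_S, 2)` is the number of `(S, {T, T'})` with two distinct triangles inside `S` — at most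
`C(s₃, 2)·(1 + n + C(n, 2))` (two distinct triangles share `≤ 1` point under (C1), so `S ∖ (T ∪ T')` has `≤ 2` points). Hence
**`ncard_indep_seven_add_le`**: `#{independent 7-sets} + s₃·C(n − 3, 4) ≤ C(n, 7) + C(s₃, 2)·(1 + n + C(n, 2))`.
On the level-`7` core at `d = 8` the `s₃`-term of the pair count is `20 %` of the budget and this takes `5/(n − 7)` of it off —
the row `43`'s missing `1.2 %` (work/tools/price_43.py). Axioms: standard.
-/

open scoped Matroid

namespace PercRepro

namespace S1

open Set Finset

variable {α : Type}

open scoped Classical in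
/-- Two distinct triangles share at most one point under (C1). -/
theorem card_inter_le_one_of_triangles (M : Matroid α) [M.Finite]
    (hC1 : ∀ L ⊆ M.E, M.eRk L = 2 → L.ncard ≤ 3) {T T' : Finset α}
    (hT : M.IsCircuit (T : Set α)) (hT3 : T.card = 3) (hT' : M.IsCircuit (T' : Set α)) (hT'3 : T'.card = 3)
    (hne : T ≠ T') : (T ∩ T').card ≤ 1 := by
  by_contra h
  have h2 : 2 ≤ (T ∩ T').card := by omega
  have hTE : (T : Set α) ⊆ M.E := hT.subset_ground
  have hT'E : (T' : Set α) ⊆ M.E := hT'.subset_ground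
  obtain ⟨x, hx⟩ := Finset.card_pos.1 (show 0 < T.card by omega)
  obtain ⟨x', hx'⟩ := Finset.card_pos.1 (show 0 < T'.card by omega)
  have hrT : M.eRk (T : Set α) = 2 := ThmN.eRk_eq_two_of_mem_trianglesThrough M
    (x := x) ⟨hT, by rw [Set.ncard_coe_finset, hT3], Finset.mem_coe.2 hx⟩
  have hrT' : M.eRk (T' : Set α) = 2 := ThmN.eRk_eq_two_of_mem_trianglesThrough M
    (x := x') ⟨hT', by rw [Set.ncard_coe_finset, hT'3], Finset.mem_coe.2 hx'⟩
  -- the intersection is independent (a proper subset of the circuit `T`), of rank `≥ 2`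
  have hint : ((T ∩ T' : Finset α) : Set α) ⊂ (T : Set α) := by
    rw [Finset.coe_inter]
    refine (Set.inter_subset_left).ssubset_of_ne ?_
    intro heq
    have hsub : T ⊆ T' := by
      intro x hx
      have : x ∈ ((T : Set α) ∩ (T' : Set α)) := by rw [heq]; exact hx
      exact this.2
    exact hne (Finset.eq_of_subset_of_card_le hsub (by omega))
  have hind : M.Indep ((T ∩ T' : Finset α) : Set α) := hT.ssubset_indep hint
  have hrI : M.eRk ((T ∩ T' : Finset α) : Set α) = (T ∩ T').card := by
    rw [hind.eRk_eq_encard, Set.encard_coe_eq_coe_finsetCard]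
  -- submodularity: `r(T ∪ T') + r(T ∩ T') ≤ r(T) + r(T')`
  have hsm := M.eRk_inter_add_eRk_union_le (T : Set α) (T' : Set α)
  rw [hrT, hrT', ← Finset.coe_inter, hrI] at hsm
  have hU : M.eRk ((T : Set α) ∪ (T' : Set α)) ≤ 2 := by
    have h2' : (2 : ℕ∞) ≤ ((T ∩ T').card : ℕ∞) := by exact_mod_cast h2
    have hne' : M.eRk ((T : Set α) ∪ (T' : Set α)) ≠ ⊤ :=
      ((M.eRk_le_encard _).trans_lt (Set.toFinite _).encard_lt_top).ne
    obtain ⟨u, hu⟩ := ENat.ne_top_iff_exists.1 hne'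
    rw [← hu] at hsm ⊢
    have : (T ∩ T').card + u ≤ 4 := by exact_mod_cast hsm
    exact_mod_cast (show u ≤ 2 by omega)
  -- `T ∪ T'` has `≥ 4` points of rank `≤ 2` — against (C1) (rank exactly `2` as `T ⊆ T ∪ T'`)
  have hU2 : M.eRk ((T : Set α) ∪ (T' : Set α)) = 2 := by
    refine le_antisymm hU ?_
    rw [← hrT]
    exact M.eRk_mono Set.subset_union_left
  have hcard : 4 ≤ ((T : Set α) ∪ (T' : Set α)).ncard := by
    rw [← Finset.coe_union, Set.ncard_coe_finset]
    have := Finset.card_union_add_card_inter T T'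
    have hlt : (T ∩ T').card < 3 := by
      have := Finset.card_le_card (Finset.inter_subset_left (s₂ := T') (s₁ := T))
      rcases Nat.lt_or_ge (T ∩ T').card 3 with h | h
      · exact h
      · exfalso
        have heq : T ∩ T' = T := Finset.eq_of_subset_of_card_le Finset.inter_subset_left (by omega)
        have hsub : T ⊆ T' := by
          intro x hx
          rw [← heq] at hx
          exact (Finset.mem_inter.1 hx).2
        exact hne (Finset.eq_of_subset_of_card_le hsub (by omega))
    omega
  have := hC1 _ (Set.union_subset hTE hT'E) hU2
  omega

open scoped Classical in
/-- A `3`-set `T ⊆ E` lies in at least `C(n − 3, 4)` seven-subsets of `E` (`U ↦ U ∪ T` from the `4`-subsets of `E ∖ T`). -/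
theorem card_filter_superset_ge (Ef : Finset α) {T : Finset α} (hT : T ⊆ Ef) (hT3 : T.card = 3) :
    (Ef.card - 3).choose 4 ≤ ((Ef.powersetCard 7).filter (fun S => T ⊆ S)).card := by
  have hmaps : ∀ U ∈ (Ef \ T).powersetCard 4, U ∪ T ∈ (Ef.powersetCard 7).filter (fun S => T ⊆ S) := by
    intro U hU
    rw [Finset.mem_powersetCard] at hU
    rw [Finset.mem_filter, Finset.mem_powersetCard]
    refine ⟨⟨Finset.union_subset (hU.1.trans Finset.sdiff_subset) hT, ?_⟩, Finset.subset_union_right⟩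
    rw [Finset.card_union_of_disjoint (Finset.disjoint_of_subset_left hU.1 Finset.sdiff_disjoint), hU.2, hT3]
  have hinj : Set.InjOn (fun U => U ∪ T) ((Ef \ T).powersetCard 4 : Set (Finset α)) := by
    intro U hU U' hU' h
    simp only at h
    rw [Finset.mem_coe, Finset.mem_powersetCard] at hU hU'
    have e1 : (U ∪ T) \ T = U := by
      rw [Finset.union_sdiff_right]
      exact Finset.sdiff_eq_self_of_disjoint (Finset.disjoint_of_subset_left hU.1 Finset.sdiff_disjoint)
    have e2 : (U' ∪ T) \ T = U' := by
      rw [Finset.union_sdiff_right]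
      exact Finset.sdiff_eq_self_of_disjoint (Finset.disjoint_of_subset_left hU'.1 Finset.sdiff_disjoint)
    rw [← e1, ← e2, h]
  have := Finset.card_le_card_of_injOn (fun U => U ∪ T) hmaps hinj
  rwa [Finset.card_powersetCard, Finset.card_sdiff_of_subset hT, hT3] at this

open scoped Classical in
/-- Two `3`-sets sharing `≤ 1` point lie together in at most `1 + n + C(n, 2)` seven-subsets of `E`
(`S ↦ S ∖ (T ∪ T')` has `≤ 2` points). -/
theorem card_filter_superset_pair_le (Ef : Finset α) {T T' : Finset α} (hT3 : T.card = 3) (hT'3 : T'.card = 3)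
    (hint : (T ∩ T').card ≤ 1) :
    ((Ef.powersetCard 7).filter (fun S => T ⊆ S ∧ T' ⊆ S)).card ≤ 1 + Ef.card + Ef.card.choose 2 := by
  have hU5 : 5 ≤ (T ∪ T').card := by
    have := Finset.card_union_add_card_inter T T'
    omega
  set Tgt := Ef.powersetCard 0 ∪ Ef.powersetCard 1 ∪ Ef.powersetCard 2 with hTgt
  have hmaps : ∀ S ∈ (Ef.powersetCard 7).filter (fun S => T ⊆ S ∧ T' ⊆ S), S \ (T ∪ T') ∈ Tgt := by
    intro S hS
    rw [Finset.mem_filter, Finset.mem_powersetCard] at hS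
    have hsub : T ∪ T' ⊆ S := Finset.union_subset hS.2.1 hS.2.2
    have hc : (S \ (T ∪ T')).card = 7 - (T ∪ T').card := by rw [Finset.card_sdiff_of_subset hsub, hS.1.2]
    have hle : (T ∪ T').card ≤ 7 := by rw [← hS.1.2]; exact Finset.card_le_card hsub
    have hE : S \ (T ∪ T') ⊆ Ef := Finset.sdiff_subset.trans hS.1.1
    rw [hTgt, Finset.mem_union, Finset.mem_union, Finset.mem_powersetCard, Finset.mem_powersetCard,
      Finset.mem_powersetCard]
    rcases Nat.lt_or_ge (S \ (T ∪ T')).card 1 with h | h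
    · exact Or.inl (Or.inl ⟨hE, by omega⟩)
    · rcases Nat.lt_or_ge (S \ (T ∪ T')).card 2 with h' | h'
      · exact Or.inl (Or.inr ⟨hE, by omega⟩)
      · exact Or.inr ⟨hE, by omega⟩
  have hinj : Set.InjOn (fun S => S \ (T ∪ T'))
      ((Ef.powersetCard 7).filter (fun S => T ⊆ S ∧ T' ⊆ S) : Set (Finset α)) := by
    intro S hS S' hS' h
    simp only at h
    rw [Finset.mem_coe, Finset.mem_filter] at hS hS'
    have e1 : S \ (T ∪ T') ∪ (T ∪ T') = S := Finset.sdiff_union_of_subset (Finset.union_subset hS.2.1 hS.2.2)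
    have e2 : S' \ (T ∪ T') ∪ (T ∪ T') = S' := Finset.sdiff_union_of_subset (Finset.union_subset hS'.2.1 hS'.2.2)
    rw [← e1, ← e2, h]
  have := Finset.card_le_card_of_injOn (fun S => S \ (T ∪ T')) hmaps hinj
  refine this.trans ?_
  calc Tgt.card ≤ (Ef.powersetCard 0 ∪ Ef.powersetCard 1).card + (Ef.powersetCard 2).card := Finset.card_union_le _ _
    _ ≤ (Ef.powersetCard 0).card + (Ef.powersetCard 1).card + (Ef.powersetCard 2).card :=
        Nat.add_le_add_right (Finset.card_union_le _ _) _
    _ = 1 + Ef.card + Ef.card.choose 2 := by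
        rw [Finset.card_powersetCard, Finset.card_powersetCard, Finset.card_powersetCard, Nat.choose_zero_right,
          Nat.choose_one_right]

/-- `m ≤ 1 + C(m, 2)`. -/
theorem le_one_add_choose_two (m : ℕ) : m ≤ 1 + m.choose 2 := by
  rcases m with _ | _ | m
  · simp
  · simp
  · have h : (m + 1 + 1).choose 2 = (m + 1).choose 1 + (m + 1).choose 2 := Nat.choose_succ_succ' (m + 1) 1
    rw [Nat.choose_one_right] at h
    omega

open scoped Classical in
/-- **THE INDEPENDENT `7`-SETS AGAINST THE TRIANGLES (Bonferroni)**: under (C1),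
`#{independent 7-sets} + s₃·C(n − 3, 4) ≤ C(n, 7) + C(s₃, 2)·(1 + n + C(n, 2))` — the `7`-sets containing a triangle are
dependent; every triangle lies in `≥ C(n − 3, 4)` of them; a `7`-set with `m ≥ 1` triangles is counted `m ≤ 1 + C(m, 2)`
times, and the pairs of triangles inside a `7`-set number at most `C(s₃, 2)·(1 + n + C(n, 2))` in all. -/
theorem ncard_indep_seven_add_le (M : Matroid α) [M.Finite]
    (hC1 : ∀ L ⊆ M.E, M.eRk L = 2 → L.ncard ≤ 3) :
    {I : Set α | I ⊆ M.E ∧ M.eRk I = 7 ∧ I.ncard = 7}.ncard + (ThmN.triangles M).ncard * (M.E.ncard - 3).choose 4 ≤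
      M.E.ncard.choose 7 + ((ThmN.triangles M).ncard).choose 2 * (1 + M.E.ncard + M.E.ncard.choose 2) := by
  set Ef := Matroid.groundF M with hEf
  have hE : (Ef : Set α) = M.E := Matroid.coe_groundF M
  have hEcard : Ef.card = M.E.ncard := Matroid.card_groundF M
  set 𝒯 : Finset (Finset α) := (Ef.powersetCard 3).filter (fun T : Finset α => M.IsCircuit ((T : Finset α) : Set α)) with h𝒯
  set 𝒮 := Ef.powersetCard 7 with h𝒮
  set ℐ := 𝒮.filter (fun S : Finset α => M.eRk ((S : Finset α) : Set α) = 7) with hℐ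
  set 𝒟 := 𝒮.filter (fun S : Finset α => ∃ T ∈ 𝒯, T ⊆ S) with h𝒟
  -- (1) the triangles as finsets
  have h𝒯card : (ThmN.triangles M).ncard = 𝒯.card := by
    have himg : ThmN.triangles M = (𝒯.image (fun T : Finset α => (T : Set α)) : Set (Set α)) := by
      ext C
      simp only [ThmN.triangles, Set.mem_setOf_eq, Finset.coe_image, Set.mem_image, Finset.mem_coe, h𝒯,
        Finset.mem_filter, Finset.mem_powersetCard]
      constructor
      · rintro ⟨hC, hC3⟩
        have hCfin : C.Finite := M.ground_finite.subset hC.subset_ground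
        refine ⟨hCfin.toFinset, ⟨⟨?_, ?_⟩, ?_⟩, hCfin.coe_toFinset⟩
        · intro x hx
          rw [Set.Finite.mem_toFinset] at hx
          rw [← Finset.mem_coe, hE]
          exact hC.subset_ground hx
        · rw [← Set.ncard_eq_toFinset_card _ hCfin]; exact hC3
        · rw [hCfin.coe_toFinset]; exact hC
      · rintro ⟨T, ⟨⟨_, hT3⟩, hT⟩, rfl⟩
        exact ⟨hT, by rw [Set.ncard_coe_finset]; exact hT3⟩
    rw [himg, Set.ncard_coe_finset, Finset.card_image_of_injective _ Finset.coe_injective]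
  -- (2) the independent `7`-sets as finsets
  have hℐcard : {I : Set α | I ⊆ M.E ∧ M.eRk I = 7 ∧ I.ncard = 7}.ncard = ℐ.card := by
    have himg : {I : Set α | I ⊆ M.E ∧ M.eRk I = 7 ∧ I.ncard = 7} =
        (ℐ.image (fun S : Finset α => (S : Set α)) : Set (Set α)) := by
      ext I
      simp only [Set.mem_setOf_eq, Finset.coe_image, Set.mem_image, Finset.mem_coe, hℐ, h𝒮,
        Finset.mem_filter, Finset.mem_powersetCard]
      constructor
      · rintro ⟨hIE, hIr, hI7⟩
        have hIfin : I.Finite := M.ground_finite.subset hIE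
        refine ⟨hIfin.toFinset, ⟨⟨?_, ?_⟩, ?_⟩, hIfin.coe_toFinset⟩
        · intro x hx
          rw [Set.Finite.mem_toFinset] at hx
          rw [← Finset.mem_coe, hE]
          exact hIE hx
        · rw [← Set.ncard_eq_toFinset_card _ hIfin]; exact hI7
        · rw [hIfin.coe_toFinset]; exact hIr
      · rintro ⟨S, ⟨⟨hSE, hS7⟩, hSr⟩, rfl⟩
        refine ⟨?_, hSr, by rw [Set.ncard_coe_finset]; exact hS7⟩
        rw [← hE]; exact Finset.coe_subset.2 hSE
    rw [himg, Set.ncard_coe_finset, Finset.card_image_of_injective _ Finset.coe_injective]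
  -- (3) `ℐ` and `𝒟` are disjoint subsets of `𝒮`
  have hdisj : Disjoint ℐ 𝒟 := by
    rw [Finset.disjoint_left]
    intro S hS hS'
    rw [hℐ, Finset.mem_filter] at hS
    rw [h𝒟, Finset.mem_filter] at hS'
    obtain ⟨T, hT, hTS⟩ := hS'.2
    rw [h𝒯, Finset.mem_filter] at hT
    have hS7 : S.card = 7 := (Finset.mem_powersetCard.1 hS.1).2
    have hSind : M.Indep (S : Set α) := by
      rw [Matroid.indep_iff_eRk_eq_encard_of_finite (Finset.finite_toSet S), hS.2,
        Set.encard_coe_eq_coe_finsetCard, hS7]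
      rfl
    exact hT.2.dep.not_indep (hSind.subset (Finset.coe_subset.2 hTS))
  have hIDle : ℐ.card + 𝒟.card ≤ 𝒮.card := by
    rw [← Finset.card_union_of_disjoint hdisj]
    exact Finset.card_le_card (Finset.union_subset (Finset.filter_subset _ _) (Finset.filter_subset _ _))
  have h𝒮card : 𝒮.card = M.E.ncard.choose 7 := by rw [h𝒮, Finset.card_powersetCard, hEcard]
  -- (4) the double count `Σ_T #{S ⊇ T} = Σ_S m_S`
  have hswap : ∑ T ∈ 𝒯, ∑ S ∈ 𝒮, (if T ⊆ S then 1 else 0) =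
      ∑ S ∈ 𝒮, ∑ T ∈ 𝒯, (if T ⊆ S then 1 else 0) := Finset.sum_comm
  have hleft : 𝒯.card * (M.E.ncard - 3).choose 4 ≤ ∑ T ∈ 𝒯, ∑ S ∈ 𝒮, (if T ⊆ S then 1 else 0) := by
    calc 𝒯.card * (M.E.ncard - 3).choose 4 = ∑ _T ∈ 𝒯, (M.E.ncard - 3).choose 4 := by
          rw [Finset.sum_const, smul_eq_mul]
      _ ≤ ∑ T ∈ 𝒯, ∑ S ∈ 𝒮, (if T ⊆ S then 1 else 0) := by
          apply Finset.sum_le_sum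
          intro T hT
          rw [Finset.sum_boole, Nat.cast_id]
          rw [h𝒯, Finset.mem_filter, Finset.mem_powersetCard] at hT
          have := card_filter_superset_ge Ef hT.1.1 hT.1.2
          rwa [hEcard] at this
  -- the multiplicity `m S`, and `m S ≤ [S ∈ 𝒟] + C(m S, 2)`
  set m : Finset α → ℕ := fun S => (𝒯.filter (fun T => T ⊆ S)).card with hm
  have hrow : ∀ S ∈ 𝒮, ∑ T ∈ 𝒯, (if T ⊆ S then 1 else 0) = m S := by
    intro S _
    rw [Finset.sum_boole, Nat.cast_id]
  have hmS : ∀ S ∈ 𝒮, m S ≤ (if S ∈ 𝒟 then 1 else 0) + (m S).choose 2 := by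
    intro S hS
    by_cases h0 : m S = 0
    · rw [h0]; exact Nat.zero_le _
    · have hD : S ∈ 𝒟 := by
        rw [h𝒟, Finset.mem_filter]
        refine ⟨hS, ?_⟩
        obtain ⟨T, hT⟩ := Finset.card_pos.1 (Nat.pos_of_ne_zero h0)
        rw [Finset.mem_filter] at hT
        exact ⟨T, hT.1, hT.2⟩
      rw [if_pos hD]
      exact le_one_add_choose_two _
  -- the pairs of triangles inside `S`
  have hpairs : ∀ S ∈ 𝒮, (m S).choose 2 =
      ∑ P ∈ 𝒯.powersetCard 2, (if ∀ T ∈ P, T ⊆ S then 1 else 0) := by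
    intro S _
    rw [Finset.sum_boole, Nat.cast_id, hm]
    simp only
    rw [← Finset.card_powersetCard]
    congr 1
    ext P
    simp only [Finset.mem_powersetCard, Finset.mem_filter, Finset.subset_iff]
    constructor
    · rintro ⟨hP, hP2⟩
      exact ⟨⟨fun T hT => (hP hT).1, hP2⟩, fun T hT => (hP hT).2⟩
    · rintro ⟨⟨hP, hP2⟩, hPS⟩
      exact ⟨fun T hT => ⟨hP hT, hPS T hT⟩, hP2⟩
  have hpairs_le : ∑ S ∈ 𝒮, (m S).choose 2 ≤ 𝒯.card.choose 2 * (1 + M.E.ncard + M.E.ncard.choose 2) := by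
    rw [Finset.sum_congr rfl hpairs, Finset.sum_comm]
    calc ∑ P ∈ 𝒯.powersetCard 2, ∑ S ∈ 𝒮, (if ∀ T ∈ P, T ⊆ S then 1 else 0)
        ≤ ∑ _P ∈ 𝒯.powersetCard 2, (1 + M.E.ncard + M.E.ncard.choose 2) := by
          apply Finset.sum_le_sum
          intro P hP
          rw [Finset.sum_boole, Nat.cast_id]
          rw [Finset.mem_powersetCard] at hP
          obtain ⟨T, T', hne, rfl⟩ := Finset.card_eq_two.1 hP.2
          have hT : T ∈ 𝒯 := hP.1 (Finset.mem_insert_self _ _)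
          have hT' : T' ∈ 𝒯 := hP.1 (Finset.mem_insert_of_mem (Finset.mem_singleton_self _))
          rw [h𝒯, Finset.mem_filter, Finset.mem_powersetCard] at hT hT'
          have hint := card_inter_le_one_of_triangles M hC1 hT.2 hT.1.2 hT'.2 hT'.1.2 hne
          have hfeq : 𝒮.filter (fun S => ∀ U ∈ ({T, T'} : Finset (Finset α)), U ⊆ S) =
              𝒮.filter (fun S => T ⊆ S ∧ T' ⊆ S) := by
            apply Finset.filter_congr
            intro S _
            simp only [Finset.mem_insert, Finset.mem_singleton, forall_eq_or_imp, forall_eq]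
          rw [hfeq]
          have := card_filter_superset_pair_le Ef hT.1.2 hT'.1.2 hint
          rwa [hEcard] at this
      _ = 𝒯.card.choose 2 * (1 + M.E.ncard + M.E.ncard.choose 2) := by
          rw [Finset.sum_const, smul_eq_mul, Finset.card_powersetCard]
  have hright : ∑ S ∈ 𝒮, ∑ T ∈ 𝒯, (if T ⊆ S then 1 else 0) ≤
      𝒟.card + 𝒯.card.choose 2 * (1 + M.E.ncard + M.E.ncard.choose 2) := by
    rw [Finset.sum_congr rfl hrow]
    calc ∑ S ∈ 𝒮, m S ≤ ∑ S ∈ 𝒮, ((if S ∈ 𝒟 then 1 else 0) + (m S).choose 2) := Finset.sum_le_sum hmS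
      _ = ∑ S ∈ 𝒮, (if S ∈ 𝒟 then 1 else 0) + ∑ S ∈ 𝒮, (m S).choose 2 := Finset.sum_add_distrib
      _ = 𝒟.card + ∑ S ∈ 𝒮, (m S).choose 2 := by
          rw [Finset.sum_boole, Nat.cast_id, Finset.filter_mem_eq_inter,
            Finset.inter_eq_right.2 (Finset.filter_subset _ _)]
      _ ≤ 𝒟.card + 𝒯.card.choose 2 * (1 + M.E.ncard + M.E.ncard.choose 2) := Nat.add_le_add_left hpairs_le _
  rw [h𝒯card, hℐcard]
  omega

end S1

end PercRepro
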